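import Literature.Probability.Process.NestedStoppedMartingales
import Literature.Probability.Process.MartingaleLimit
import HarnessLib

/-!
# Freezing a bounded local martingale at the end of its stochastic interval

Topic `Probability/Process`; generic (any filtered finite measure space, raw filtration, no usual
conditions); theorems and one definition, no named fact. This is the abstract form of the step
"`(M_t, t < T)` is a bounded (local) martingale, hence `M_t` converges a.s. when `t ↑ T`; extend
`M` past `T` by its left limit: the extension is a bounded martingale on `[0, ∞)`" as it is used
for the restriction martingales of Lawler–Schramm–Werner (2003) (proof of Thm. 6.1: "By the
martingale convergence theorem, the a.s. limit `Y_T := lim_{t ↗ T} Y_t` exists"; end of the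
proof of Thm. 8.4: "since `M_t` converges a.s. and in `L¹` when `t → T`"), written once and for all
for a bounded process `Y` and a non-decreasing sequence of optional times `τ₀ ≤ τ₁ ≤ ⋯`
(a localising sequence of the stochastic interval `⋃ₖ [0, τ_k]`) such that every stopped process
`Y^{τ_k}` is a martingale with a.s. continuous paths:

* `frozenLimit Y τ t ω = limsup_k Y^{τ_k}_t(ω)` — the frozen extension `Ȳ`;
* pathwise: `|Ȳ| ≤ C` if `|Y| ≤ C` (`abs_frozenLimit_le`, `frozenLimit_mem_Icc`); `Ȳ_t = Y_t`
  as soon as `t ≤ τ_k` for some `k` (`frozenLimit_eq_of_le`); and on the event where the nested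
  stopped paths are uniformly Cauchy (`Process.ae_nested_stoppedProcess_cauchy`) and all `τ_k`
  are finite there is a terminal value `L` with `Ȳ_t = L` at every `t ≥ sup_k τ_k`, `Ȳ_s → L`
  as `s ↑ τ∞` whenever the `τ_k < τ∞` exhaust `[0, τ∞)`, and `Ȳ_t → L` as `t → ∞` when the
  `τ_k` exhaust `[0, ∞)` (`exists_frozen_of_cauchy`);
* `martingale_frozenLimit` — **`Ȳ` is a bounded `𝓕`-martingale** (bounded a.s. limit of the
  martingales `Y^{τ_k}`, `Process.martingale_of_tendsto_of_abs_le`), strongly adapted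
  (`stronglyAdapted_frozenLimit`), with `Y^{τ_k}_t → Ȳ_t` a.s. at all times
  (`ae_tendsto_frozenLimit`) and the frozen behaviour a.s. (`ae_exists_frozen`).

The tree's `SLERestrictionConvergence` / `SLERestrictionMartingaleExists` carry out exactly this
argument for the SLE_{8/3} restriction martingale of [LSW] Prop. 5.2/5.3; this file abstracts it
so that other local martingales on stochastic intervals (the one-sided martingale of [LSW]
Lemma 8.9, the compensated martingales of [LSW] Thm. 6.5) can be frozen by instantiation.

## References

* D. Revuz, M. Yor, *Continuous Martingales and Brownian Motion* (3rd ed., 1999), Ch. IV §1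
  (continuous local martingales on stochastic intervals, Prop. (1.23)), Ch. II Thm (2.10)
  (convergence of bounded martingales).
* G. F. Lawler, O. Schramm, W. Werner, *Conformal restriction: the chordal case*, J. Amer. Math.
  Soc. 16 (2003), proof of Thm. 6.1 and end of the proof of Thm. 8.4.
  [LawlerSchrammWerner2003Restriction]
-/

noncomputable section

open MeasureTheory Filter Topology Set
open scoped NNReal

namespace Literature.Probability.Process

variable {Ω : Type*} {m : MeasurableSpace Ω} {𝓕 : Filtration ℝ≥0 m} {P : Measure Ω}
  {Y : ℝ≥0 → Ω → ℝ} {τ : ℕ → Ω → WithTop ℝ≥0} {C : ℝ}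

/-- **The frozen extension `Ȳ_t = limsup_k Y^{τ_k}_t`** of a process `Y` along a sequence of
random times `τ_k` (the a.s. limit of the stopped processes when these are nested bounded
continuous martingales). Revuz–Yor (1999), Ch. IV §1. [folklore] -/
def frozenLimit (Y : ℝ≥0 → Ω → ℝ) (τ : ℕ → Ω → WithTop ℝ≥0) (t : ℝ≥0) (ω : Ω) : ℝ :=
  limsup (fun k ↦ stoppedProcess Y (τ k) t ω) atTop

/-! ### Pathwise properties -/

section Pathwise

omit m in
/-- Values of the frozen extension lie in any interval containing the values of `Y`. [folklore] -/
theorem frozenLimit_mem_Icc {a b : ℝ} (h : ∀ t ω, Y t ω ∈ Icc a b) (t : ℝ≥0) (ω : Ω) :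
    frozenLimit Y τ t ω ∈ Icc a b := by
  rw [frozenLimit]
  have hb : ∀ k : ℕ, stoppedProcess Y (τ k) t ω ≤ b := fun k ↦ (h _ ω).2
  have ha : ∀ k : ℕ, a ≤ stoppedProcess Y (τ k) t ω := fun k ↦ (h _ ω).1
  have hbdd : IsBoundedUnder (· ≤ ·) atTop fun k : ℕ ↦ stoppedProcess Y (τ k) t ω :=
    ⟨b, eventually_map.2 (Eventually.of_forall hb)⟩
  have hbddb : IsBoundedUnder (· ≥ ·) atTop fun k : ℕ ↦ stoppedProcess Y (τ k) t ω :=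
    ⟨a, eventually_map.2 (Eventually.of_forall ha)⟩
  exact ⟨le_limsup_of_frequently_le (Frequently.of_forall ha) hbdd,
    limsup_le_of_le hbddb.isCoboundedUnder_le (Eventually.of_forall hb)⟩

omit m in
/-- `|Ȳ| ≤ C` when `|Y| ≤ C`. [folklore] -/
theorem abs_frozenLimit_le (hC : ∀ t ω, |Y t ω| ≤ C) (t : ℝ≥0) (ω : Ω) :
    |frozenLimit Y τ t ω| ≤ C := by
  have h := frozenLimit_mem_Icc (τ := τ) (a := -C) (b := C)
    (fun t ω ↦ ⟨neg_le_of_abs_le (hC t ω), le_of_abs_le (hC t ω)⟩) t ω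
  exact abs_le.2 ⟨h.1, h.2⟩

omit m in
/-- **Before the localising times `Ȳ = Y`**: if `t ≤ τ_k(ω)` for some `k` (and the `τ_k` are
non-decreasing in `k`) then `Ȳ_t(ω) = Y_t(ω)`. [folklore] -/
theorem frozenLimit_eq_of_le (hτ : ∀ ω, Monotone (τ · ω)) {t : ℝ≥0} {ω : Ω} {k : ℕ}
    (h : (t : WithTop ℝ≥0) ≤ τ k ω) : frozenLimit Y τ t ω = Y t ω := by
  have hev : ∀ᶠ J in atTop, stoppedProcess Y (τ J) t ω = Y t ω := by
    filter_upwards [eventually_ge_atTop k] with J hJ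
    exact stoppedProcess_eq_of_le (h.trans (hτ ω hJ))
  rw [frozenLimit]
  exact (tendsto_const_nhds.congr' (EventuallyEq.symm hev)).limsup_eq

omit m in
/-- On the Cauchy event the stopped values converge to `Ȳ` at every time. [folklore] -/
theorem tendsto_frozenLimit_of_cauchy {ω : Ω}
    (hω : ∀ ε : ℝ, 0 < ε → ∃ K : ℕ, ∀ k, K ≤ k → ∀ J, k ≤ J → ∀ r : ℝ≥0,
      |stoppedProcess Y (τ J) r ω - stoppedProcess Y (τ k) r ω| ≤ ε) (t : ℝ≥0) :
    Tendsto (fun k ↦ stoppedProcess Y (τ k) t ω) atTop (𝓝 (frozenLimit Y τ t ω)) := by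
  -- the sequence `k ↦ Y^{τ_k}_t(ω)` is Cauchy, hence converges, and its limit is its `limsup`
  set x : ℕ → ℝ := fun k ↦ stoppedProcess Y (τ k) t ω with hx
  have hcs : CauchySeq x := by
    rw [Metric.cauchySeq_iff']
    intro ε hε
    obtain ⟨K, hK⟩ := hω (ε / 2) (by positivity)
    refine ⟨K, fun J hJ ↦ ?_⟩
    rw [Real.dist_eq]
    exact lt_of_le_of_lt (hK K le_rfl J hJ t) (by linarith)
  obtain ⟨c, hc'⟩ := cauchySeq_tendsto_of_complete hcs
  rw [frozenLimit, ← hx, hc'.limsup_eq]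
  exact hc'

omit m in
/-- **On the Cauchy event `Ȳ` is frozen at the terminal time** `τ∞ = sup_k τ_k` (all `τ_k`
finite, non-decreasing): there is `L` — the limit of the frozen values `Y_{τ_k}` — with
(i) `Ȳ_t = L` at every time `t` beyond all `τ_k`; (ii) if the `τ_k` are `< τ₀` and every `s < τ₀`
is `≤` some `τ_k`, then `Ȳ_s → L` as `s ↑ τ₀`; (iii) if every `t` is `≤` some `τ_k`, then
`Ȳ_t → L` as `t → ∞`. Revuz–Yor (1999), Ch. IV §1 with Ch. II Thm (2.10).
[cite: LawlerSchrammWerner2003Restriction, proof of Thm. 6.1 and end of the proof of Thm. 8.4] -/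
theorem exists_frozen_of_cauchy (hτ : ∀ ω, Monotone (τ · ω)) {ω : Ω} (hfin : ∀ k, τ k ω ≠ ⊤)
    (hω : ∀ ε : ℝ, 0 < ε → ∃ K : ℕ, ∀ k, K ≤ k → ∀ J, k ≤ J → ∀ r : ℝ≥0,
      |stoppedProcess Y (τ J) r ω - stoppedProcess Y (τ k) r ω| ≤ ε) :
    ∃ L : ℝ, (∀ t : ℝ≥0, (∀ k, τ k ω ≤ t) → frozenLimit Y τ t ω = L) ∧
      (∀ τ₀ : ℝ≥0, (∀ k, τ k ω < τ₀) → (∀ s : ℝ≥0, s < τ₀ → ∃ k, (s : WithTop ℝ≥0) ≤ τ k ω) →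
        Tendsto (fun s ↦ frozenLimit Y τ s ω) (𝓝[<] τ₀) (𝓝 L)) ∧
      ((∀ t : ℝ≥0, ∃ k, (t : WithTop ℝ≥0) ≤ τ k ω) →
        Tendsto (fun t ↦ frozenLimit Y τ t ω) atTop (𝓝 L)) := by
  -- the localising times as finite times `σ k`
  set σ : ℕ → ℝ≥0 := fun k ↦ (τ k ω).untop (hfin k) with hσ
  have hσeq : ∀ k, τ k ω = σ k := fun k ↦ (WithTop.coe_untop _ (hfin k)).symm
  have hσmono : Monotone σ := fun k J hkJ ↦ by
    have h1 : τ k ω ≤ τ J ω := hτ ω hkJ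
    rw [hσeq, hσeq] at h1
    exact_mod_cast h1
  -- the frozen values `y k = Y_{σ k}` and their limit
  set y : ℕ → ℝ := fun k ↦ Y (σ k) ω with hy
  have hstop_ge : ∀ k (r : ℝ≥0), σ k ≤ r → stoppedProcess Y (τ k) r ω = y k := fun k r hr ↦ by
    rw [stoppedProcess_eq_of_ge (by rw [hσeq]; exact_mod_cast hr), hσeq]
    rfl
  have hycauchy : ∀ ε : ℝ, 0 < ε → ∃ K, ∀ k, K ≤ k → ∀ J, k ≤ J → |y J - y k| ≤ ε := by
    intro ε hε
    obtain ⟨K, hK⟩ := hω ε hε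
    refine ⟨K, fun k hk J hJ ↦ ?_⟩
    have := hK k hk J hJ (σ J)
    rwa [hstop_ge J (σ J) le_rfl, hstop_ge k (σ J) (hσmono hJ)] at this
  obtain ⟨L, hL⟩ : ∃ L, Tendsto y atTop (𝓝 L) := by
    refine cauchySeq_tendsto_of_complete (Metric.cauchySeq_iff'.2 fun ε hε ↦ ?_)
    obtain ⟨K, hK⟩ := hycauchy (ε / 2) (by positivity)
    exact ⟨K, fun J hJ ↦ by rw [Real.dist_eq]; exact lt_of_le_of_lt (hK K le_rfl J hJ) (by linarith)⟩
  have hLy : ∀ ε : ℝ, 0 < ε → ∃ K, ∀ k, K ≤ k → |L - y k| ≤ ε := fun ε hε ↦ by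
    obtain ⟨K, hK⟩ := hycauchy ε hε
    refine ⟨K, fun k hk ↦ ?_⟩
    have : Tendsto (fun J ↦ |y J - y k|) atTop (𝓝 |L - y k|) := (hL.sub tendsto_const_nhds).abs
    exact le_of_tendsto this (eventually_atTop.2 ⟨k, fun J hJ ↦ hK k hk J hJ⟩)
  -- the key estimate: `|Ȳ_s - L| ≤ 2ε/3 + ε/3` for `s ≥ σ k`, `k` large, `s ≤ τ J` for some `J`
  have hclose : ∀ ε : ℝ, 0 < ε → ∃ k : ℕ, ∀ s : ℝ≥0, σ k ≤ s →
      (∃ J, (s : WithTop ℝ≥0) ≤ τ J ω) → |frozenLimit Y τ s ω - L| < ε := by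
    intro ε hε
    obtain ⟨K, hK⟩ := hω (ε / 3) (by positivity)
    obtain ⟨K', hK'⟩ := hLy (ε / 3) (by positivity)
    refine ⟨max K K', fun s hs hJ ↦ ?_⟩
    set k := max K K' with hk
    obtain ⟨j, hj⟩ := hJ
    set J := max j k with hJdef
    have hJs : (s : WithTop ℝ≥0) ≤ τ J ω := hj.trans (hτ ω (le_max_left _ _))
    have h1 := hK k (le_max_left _ _) J (le_max_right _ _) s
    rw [stoppedProcess_eq_of_le hJs, hstop_ge k s hs] at h1
    have h2 := hK' k (le_max_right _ _)
    rw [frozenLimit_eq_of_le hτ hJs]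
    have : |Y s ω - L| ≤ |Y s ω - y k| + |L - y k| := by
      have := abs_sub_le (Y s ω) (y k) L
      rw [abs_sub_comm (y k) L] at this; exact this
    linarith
  refine ⟨L, ?_, ?_, ?_⟩
  · -- (i) beyond all `τ_k`, `Ȳ = L`
    intro t ht
    have hev : ∀ k, stoppedProcess Y (τ k) t ω = y k := fun k ↦
      hstop_ge k t (by have := ht k; rw [hσeq] at this; exact_mod_cast this)
    rw [frozenLimit]
    simp_rw [hev]
    exact hL.limsup_eq
  · -- (ii) the left limit at `τ₀`
    intro τ₀ hlt hexh
    have hσlt : ∀ k, σ k < τ₀ := fun k ↦ by have := hlt k; rw [hσeq] at this; exact_mod_cast this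
    rw [Metric.tendsto_nhdsWithin_nhds]
    intro ε hε
    obtain ⟨k, hk⟩ := hclose ε hε
    have hσk : (σ k : ℝ) < τ₀ := by exact_mod_cast hσlt k
    refine ⟨(τ₀ : ℝ) - σ k, by linarith, fun s hs hds ↦ ?_⟩
    have hsτ : s < τ₀ := hs
    have hsτ' : (s : ℝ) ≤ τ₀ := by exact_mod_cast hsτ.le
    have hσs : σ k ≤ s := by
      rw [NNReal.dist_eq, abs_sub_comm, abs_of_nonneg (by linarith)] at hds
      have : (σ k : ℝ) ≤ s := by linarith
      exact_mod_cast this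
    rw [Real.dist_eq]
    exact hk s hσs (hexh s hsτ)
  · -- (iii) the limit at infinity
    intro hall
    refine Metric.tendsto_atTop.2 fun ε hε ↦ ?_
    obtain ⟨k, hk⟩ := hclose ε hε
    exact ⟨σ k, fun r hr ↦ by rw [Real.dist_eq]; exact hk r hr (hall r)⟩

end Pathwise

/-! ### The frozen extension is a bounded martingale -/

section Measure

variable [IsFiniteMeasure P]
  (hτ : ∀ ω, Monotone (τ · ω)) (hopt : ∀ k, IsOptionalTime 𝓕 (τ k))
  (hX : ∀ k, Martingale (stoppedProcess Y (τ k)) 𝓕 P) (hC : ∀ t ω, |Y t ω| ≤ C)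
  (hcont : ∀ k, ∀ᵐ ω ∂P, Continuous fun t ↦ stoppedProcess Y (τ k) t ω)

omit [IsFiniteMeasure P] in
include hX in
/-- `Ȳ` is strongly adapted (a `limsup` of adapted processes). [folklore] -/
theorem stronglyAdapted_frozenLimit : StronglyAdapted 𝓕 (frozenLimit Y τ) := fun t ↦
  (Measurable.limsup fun k ↦ ((hX k).stronglyMeasurable t).measurable).stronglyMeasurable

include hτ hopt hX hC hcont in
/-- **A.s., the stopped processes converge to `Ȳ` at every time** (they are a.s. uniformly
Cauchy, `ae_nested_stoppedProcess_cauchy`). [cite: RevuzYor1999, Ch. II Thm (2.10)] -/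
theorem ae_tendsto_frozenLimit :
    ∀ᵐ ω ∂P, ∀ t, Tendsto (fun k ↦ stoppedProcess Y (τ k) t ω) atTop (𝓝 (frozenLimit Y τ t ω)) := by
  filter_upwards [ae_nested_stoppedProcess_cauchy hτ hopt hX hC hcont] with ω hω t
  exact tendsto_frozenLimit_of_cauchy hω t

include hτ hopt hX hC hcont in
/-- **The frozen extension `Ȳ` is a martingale** (bounded a.s. limit of the martingales
`Y^{τ_k}`, `martingale_of_tendsto_of_abs_le`). Revuz–Yor (1999), Ch. IV Prop. (1.23) / Ch. II §1.
[cite: RevuzYor1999, Ch. IV §1] -/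
theorem martingale_frozenLimit : Martingale (frozenLimit Y τ) 𝓕 P := by
  refine martingale_of_tendsto_of_abs_le (M := fun k ↦ stoppedProcess Y (τ k)) hX
    (C := fun _ ↦ C) (fun k t ω ↦ ?_) (fun t ↦ ?_) (stronglyAdapted_frozenLimit hX)
  · simp only [stoppedProcess]
    exact hC _ ω
  · filter_upwards [ae_tendsto_frozenLimit hτ hopt hX hC hcont] with ω hω
    exact hω t

include hτ hopt hX hC hcont in
/-- **A.s., `Ȳ` is frozen at the terminal time** (the conclusions of `exists_frozen_of_cauchy`
hold almost surely on the event that all `τ_k` are finite).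
[cite: LawlerSchrammWerner2003Restriction, proof of Thm. 6.1 and end of the proof of Thm. 8.4] -/
theorem ae_exists_frozen :
    ∀ᵐ ω ∂P, (∀ k, τ k ω ≠ ⊤) →
      ∃ L : ℝ, (∀ t : ℝ≥0, (∀ k, τ k ω ≤ t) → frozenLimit Y τ t ω = L) ∧
        (∀ τ₀ : ℝ≥0, (∀ k, τ k ω < τ₀) → (∀ s : ℝ≥0, s < τ₀ → ∃ k, (s : WithTop ℝ≥0) ≤ τ k ω) →
          Tendsto (fun s ↦ frozenLimit Y τ s ω) (𝓝[<] τ₀) (𝓝 L)) ∧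
        ((∀ t : ℝ≥0, ∃ k, (t : WithTop ℝ≥0) ≤ τ k ω) →
          Tendsto (fun t ↦ frozenLimit Y τ t ω) atTop (𝓝 L)) := by
  filter_upwards [ae_nested_stoppedProcess_cauchy hτ hopt hX hC hcont] with ω hω hfin
  exact exists_frozen_of_cauchy hτ hfin hω

end Measure

end Literature.Probability.Process

end
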